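import Literature.MathematicalPhysics.QuantumFieldTheory.Balaban1983to89.B14Ineq39
import Literature.MathematicalPhysics.QuantumFieldTheory.Balaban1983to89.B15Ineq194Flow

/-!
# `Balaban1983to89.B15Claim184` — [Balaban1989LargeFieldI] p. 184: the (1.5)-functions equal 1 — the inequality
# (3.9) of [III] with `k ↦ j`, `V^{(k)}_□ ↦ V_Z^{(j)}`, `δ_k ↦ δ′_j`, PROVED in the scalar style of `B14.Ineq39`

statement-level skeleton of published theorems with citation tags; proofs where landed; nothing here is a claim about
the Yang–Mills mass gap.

CITATION HEADER (lean-in-tree rule 2026-08-18).  T. Bałaban, *Large field renormalization. I. The basic step of the 𝐑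
operation*, Commun. Math. Phys. **122**, 175–202 (1989), doi:10.1007/BF01257412, bib `Balaban1989LargeFieldI` (cell
paper B15; PDF held `paper:balaban1989-cmp122-large-field-i`, journal page = PDF page + 174; the sentence below was READ
AS AN IMAGE on the x2 render `…/1989-cmp122-large-field-I/1989-cmp122-large-field-I-p010-x2.png`, p. 184).  [III] =
T. Bałaban, *Convergent renormalization expansions for lattice gauge theories*, Commun. Math. Phys. **119**, 243–285
(1988) [Balaban1988Convergent] (cell paper B14), whose (3.9) p. 266 is the tree's `B14.Ineq39` (unit
`lit-balaban-r11`; the mechanism `norm_list_prod_sub_one_le_mul` and the axial-gauge identity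
`ratio_eq_self_of_axial` are used here BY NAME, not restated).  WHAT IS REPRODUCED: SKELETON row `B15.Claim@184`,
unit `lit-balaban-r12` gen 3 (reader/typer of block B15), HOME `run/shared/lean/pub/lit-balaban/`
(`lit-balaban-r12/ROWS-B15.md`).

THE PRINTED SENTENCE (p. 184, verbatim): *"For the functions (1.5) we use the inequality (3.9) [III], only with k
replaced by j, and the configuration V^{(k)}_□ replaced by V_Z^{(j)}. From the restrictions (1.27) we get the bound
O(1)δ′_j < ε_j, hence the functions (1.5) are equal to 1 also."*  Context: (1.5) p. 178 is the characteristic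
function `χ(|V_j(y,x) − 1| < ε_j)`, `y ∈ (Ω^{∼3}_{j+1}∖Ω^∼_{j+1})^{(j+1)} ∩ Z`, `x ∈ B(y)`, `x ≠ y`
(`B15.PrelimIntegrations.SF15`); (1.27) p. 182 restricts `|V_j(b)(V_Z^{(j)}(b))⁻¹ − 1| < 2δ′_j` bondwise
(`B15.PrelimIntegrations.SF127`), `δ′_j = g_jA₁p₁(g_j)`, `p₁(g_j) = (log g_j⁻²)^{p₁}`, `p₁ < p₀` (p. 183;
`B15.Ineq194Flow.deltaPrimeK`), and `ε_j = g_jA₀p₀(g_j)` (`Setup.epsK`).  (3.9) [III]: *"|V_k(y,x) − 1| =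
|V_k(y,x)(V^{(k)}_□(y,x))⁻¹ − 1| < O(1)δ_k = O(1)(A₁/A₀)ε_k < ε_k"* in the axial gauge for `V^{(k)}_□`.

WHAT IS TYPED AND PROVED (no carrier introduced, no unproved `Prop`).  `Claim184 v C δ′ ε` — the substituted
chain `v < C·δ′_j ∧ C·δ′_j < ε_j` for ONE real `v` (= `|V_j(y,x) − 1|` at one contour, which in the axial gauge
for `V_Z^{(j)}` equals `|V_j(y,x)(V_Z^{(j)}(y,x))⁻¹ − 1|`, `B14.Ineq39.ratio_eq_self_of_axial`) and an explicit
constant `C` in place of "O(1)"; `claim184_conclusion` (`v < ε_j`, i.e. the (1.5)-function equals 1);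
`claim184_of_bondwise` (ASSEMBLY exactly as (3.9) [III]: a product of `n` bond ratios of norm `≤ 1`, each
`2δ′_j`-close to `1` by (1.27), is `2nδ′_j`-close to `1`, so the chain holds with `C = 2n + 1` as soon as
`(2n+1)δ′_j < ε_j`); and the honest content of *"O(1)δ′_j < ε_j"*: `smallness184` — along a flow with
`0 < g_j < 1`, `C·δ′_j < ε_j` holds as soon as `C·A₁ < A₀·(log g_j⁻²)^{p₀−p₁}` (so for `g_j` small, because
`p₁ < p₀`; print states the bound without the condition).

HONEST SCOPE.  Scalar/normed-ring bookkeeping of one printed sentence; the geometry of `(Ω^{∼3}_{j+1}∖Ω^∼_{j+1})`, the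
objects `V_Z^{(j)}` (1.26) and the axial gauge itself are not modelled here (rows B15.Eq1.26/1.27 carry them as
`B15DeterminingSets.vZ`, `B15.PrelimIntegrations.SF127`).  Value = a named, kernel-checked instance of a cited
one-line inference; NOT summit progress.
-/

namespace Literature.MathematicalPhysics.QuantumFieldTheory.Balaban1983to89.B15Claim184

open B14.Ineq39 B15.Ineq194Flow

/-- **p. 184 claim** (the (1.5)-functions equal 1), verbatim: *"For the functions (1.5) we use the inequality (3.9)
[III], only with k replaced by j, and the configuration V^{(k)}_□ replaced by V_Z^{(j)}. From the restrictions (1.27)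
we get the bound O(1)δ′_j < ε_j, hence the functions (1.5) are equal to 1 also."* — the substituted (3.9)-chain for
ONE real `v` (`= |V_j(y,x) − 1|` at one contour) with an explicit constant `C` for "O(1)": `v < C·δ′_j` and
`C·δ′_j < ε_j`. [cite: Balaban1989LargeFieldI, p.184] -/
def Claim184 (v C δ' ε : ℝ) : Prop := v < C * δ' ∧ C * δ' < ε

/-- The conclusion used: `|V_j(y,x) − 1| < ε_j`, *"hence the functions (1.5) are equal to 1 also"*.
[cite: Balaban1989LargeFieldI, p.184] -/
theorem claim184_conclusion {v C δ' ε : ℝ} (h : Claim184 v C δ' ε) : v < ε := h.1.trans h.2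

/-- **The claim ASSEMBLED as (3.9) [III] is** (`B14.Ineq39.norm_list_prod_sub_one_le_mul`): if the contour ratio
`V_j(y,x)(V_Z^{(j)}(y,x))⁻¹` — equal to `V_j(y,x)` in the axial gauge for `V_Z^{(j)}`
(`B14.Ineq39.ratio_eq_self_of_axial`) — is the product of the bond ratios `l`, each of norm `≤ 1` and `2δ′_j`-close to
`1` (the restriction (1.27)), and `(2|l| + 1)δ′_j < ε_j` ("O(1)δ′_j < ε_j"), then `Claim184` holds for
`v = ‖l.prod − 1‖` with `C = 2|l| + 1`. [cite: Balaban1989LargeFieldI, p.184] -/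
theorem claim184_of_bondwise {𝔸 : Type*} [NormedRing 𝔸] (l : List 𝔸) {δ' ε : ℝ}
    (h1 : ∀ a ∈ l, ‖a‖ ≤ 1) (hθ : ∀ a ∈ l, ‖a - 1‖ ≤ 2 * δ') (hδ : 0 < δ')
    (hsmall : (2 * l.length + 1) * δ' < ε) :
    Claim184 ‖l.prod - 1‖ (2 * l.length + 1) δ' ε := by
  refine ⟨?_, hsmall⟩
  have hb := norm_list_prod_sub_one_le_mul l h1 hθ
  have : (l.length : ℝ) * (2 * δ') < (2 * l.length + 1) * δ' := by nlinarith
  linarith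

/-- **What "O(1)δ′_j < ε_j" requires.**  With `δ′_j = g_jA₁(log g_j⁻²)^{p₁}` ((1.27), `B15.Ineq194Flow.deltaPrimeK`)
and `ε_j = g_jA₀(log g_j⁻²)^{p₀}` (`Setup.epsK`): for `0 < g_j < 1` and `p₁ ≤ p₀`, `C·δ′_j < ε_j` holds as soon as
`C·A₁ < A₀·(log g_j⁻²)^{p₀−p₁}` — i.e. for `g_j` small when `p₁ < p₀` (p. 183: *"p₁ < p₀"*).
[cite: Balaban1989LargeFieldI, p.184] -/
theorem smallness184 {C A₀ A₁ : ℝ} {p₀ p₁ : ℕ} {F : Flow} {j : ℕ} (hg : 0 < F.g j) (hg1 : F.g j < 1)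
    (hp : p₁ ≤ p₀) (hC : C * A₁ < A₀ * logPow (p₀ - p₁) (F.g j)) :
    C * deltaPrimeK A₁ p₁ F j < epsK A₀ p₀ F j := by
  rw [deltaPrimeK, epsK, p0Profile_eq_mul_logPow, p0Profile_eq_mul_logPow]
  have hX : 0 < logPow p₁ (F.g j) := logPow_pos hg hg1 p₁
  have hsplit : logPow p₀ (F.g j) = logPow (p₀ - p₁) (F.g j) * logPow p₁ (F.g j) := by
    unfold logPow
    rw [← pow_add, Nat.sub_add_cancel hp]
  rw [hsplit]
  have h1 : C * (F.g j * (A₁ * logPow p₁ (F.g j))) = F.g j * logPow p₁ (F.g j) * (C * A₁) := by ring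
  have h2 : F.g j * (A₀ * (logPow (p₀ - p₁) (F.g j) * logPow p₁ (F.g j)))
      = F.g j * logPow p₁ (F.g j) * (A₀ * logPow (p₀ - p₁) (F.g j)) := by ring
  rw [h1, h2]
  exact mul_lt_mul_of_pos_left hC (mul_pos hg hX)

/-- Hence, under that smallness and the bondwise restriction (1.27) along the `n` bonds of `Γ_{y,x}` (with
`2n + 1 ≤ C`), the (1.5)-function equals 1: `‖V_j(y,x) − 1‖ < ε_j`. [cite: Balaban1989LargeFieldI, p.184] -/
theorem sf15_of_bondwise {𝔸 : Type*} [NormedRing 𝔸] (l : List 𝔸) {C A₀ A₁ : ℝ} {p₀ p₁ : ℕ} {F : Flow} {j : ℕ}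
    (h1 : ∀ a ∈ l, ‖a‖ ≤ 1) (hθ : ∀ a ∈ l, ‖a - 1‖ ≤ 2 * deltaPrimeK A₁ p₁ F j)
    (hδ : 0 < deltaPrimeK A₁ p₁ F j) (hn : 2 * (l.length : ℝ) + 1 ≤ C)
    (hg : 0 < F.g j) (hg1 : F.g j < 1) (hp : p₁ ≤ p₀) (hC : C * A₁ < A₀ * logPow (p₀ - p₁) (F.g j)) :
    ‖l.prod - 1‖ < epsK A₀ p₀ F j := by
  have hs := smallness184 (C := C) hg hg1 hp hC
  have hsmall : (2 * l.length + 1) * deltaPrimeK A₁ p₁ F j < epsK A₀ p₀ F j :=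
    lt_of_le_of_lt (mul_le_mul_of_nonneg_right hn hδ.le) hs
  exact claim184_conclusion (claim184_of_bondwise l h1 hθ hδ hsmall)

end Literature.MathematicalPhysics.QuantumFieldTheory.Balaban1983to89.B15Claim184
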